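import Summits.CriticalPhenomena.PercolationContinuityZ3.Theses.PercNonProliferation
import Summits.CriticalPhenomena.PercolationContinuityZ3.Theorems.NonProliferation.Negative.AboveSix
import Summits.CriticalPhenomena.PercolationContinuityZ3.Theorems.PercNonProliferationNonProliferationStubCellUnionBound
import Summits.CriticalPhenomena.PercolationContinuityZ3.Theorems.PercNonProliferationNonProliferationStubBoundaryGrid
import HarnessLib

/-!
# Crux `PercNonProliferation.NonProliferation` (stmt-CriticalPhenomena-4444), line `boundary-pinning` —
# the reduction: boundary two-distinct-cluster cell decay `o(ε²)` ⇒ the crux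

Lead's composition file for line `boundary-pinning` (payload slug `Sketch`,
prover-line-stmt-CriticalPhenomena-4444-c1; skeleton `Cruxes/NonProliferation/Lines/boundary_pinning.lean`).
Lands with `--supports stmt-CriticalPhenomena-4444`; it closes nothing by itself.

* `nonProliferation_of_boundaryCellTwoArm` — **the line's reduction, unconditional part fully proved**:
  IF for every `δ > 0` there is a mesh `ε ∈ (0,1]` such that, for infinitely many `n`, every cell
  `Q ⊆ ∂ⁱⁿB(2n)` of coordinate-diameter `≤ εn` carries the boundary two-DISTINCT-cluster event
  (`u, v ∈ Q` each joined inside `B(2n)` to the inner box `B(n)`, `u ↮ v` inside `B(2n)`) with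
  `P_{p_c(ℤ³)}`-probability `≤ δ ε²` (the registered OPEN stub `stub_boundaryCellTwoArm` of the line —
  the only place where `d = 3` enters), THEN `NonProliferation` holds, with `M = ⌊600/ε²⌋`, `c = 1/2`
  for the `ε` belonging to `δ = 1/1200`. Proof: grid cells of side `s = ⌊εn⌋` on `∂ⁱⁿB(2n)`
  (`stub_boundaryGrid`: `≤ 6(4n/s+2)² ≤ 600/ε²` cells once `εn ≥ 2`), pigeonhole + union bound
  (`stub_cellUnionBound`), antitonicity of `repEvent` in `M` (`Negative.repEvent_antitone`).
* `boundaryCellTwoArm_of_exp` — the natural EXPONENT form (`P ≤ C (r/n)^a` for cells of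
  coordinate-diameter `≤ r ≤ n`, with `a > 2 = dim ∂B`; predicted `a = d = 3`, measured `a_cell → 3.0`,
  kit j013488 / j014710) implies the registered `o(ε²)` form (even eventually in `n`).
-/

noncomputable section

namespace Summit.CriticalPhenomena.PercolationContinuityZ3.Theorems.NonProliferation

open MeasureTheory Filter Topology
open Literature.Probability.LatticeModels Literature.Probability.Percolation
open Summit.CriticalPhenomena.PercolationContinuityZ3.Theorems.NonProliferation.Negative

namespace BoundaryPinning

/-- Arithmetic of the mesh: if `ε ≤ 1`, `2 ≤ ε n` and `s = ⌊ε n⌋`, then `6 (4n/s + 2)² ≤ 600/ε²`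
(in the shape produced by `stub_boundaryGrid` at `d = 3`, `R = 2n`). -/
theorem grid_count_le {ε : ℝ} {n s : ℕ} (hε0 : 0 < ε) (hε1 : ε ≤ 1) (hn : 2 ≤ ε * n)
    (hs : s = ⌊ε * n⌋₊) :
    2 * (3 : ℝ) * (2 * ((2 * n : ℕ) : ℝ) / s + 2) ^ (3 - 1) ≤ 600 / ε ^ 2 := by
  have hs_gt : ε * n - 1 < s := by rw [hs]; exact Nat.sub_one_lt_floor (ε * n)
  have hs_ge : ε * n / 2 ≤ s := by linarith
  have hs_pos : (0 : ℝ) < s := by linarith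
  have h1 : 2 * ((2 * n : ℕ) : ℝ) / s ≤ 8 / ε := by
    rw [div_le_div_iff₀ hs_pos hε0]
    push_cast
    nlinarith
  have h2 : 2 * ((2 * n : ℕ) : ℝ) / s + 2 ≤ 10 / ε := by
    have h3 : (2 : ℝ) ≤ 2 / ε := by
      rw [le_div_iff₀ hε0]; nlinarith
    have h4 : 8 / ε + 2 / ε = 10 / ε := by ring
    linarith
  have h0 : (0 : ℝ) ≤ 2 * ((2 * n : ℕ) : ℝ) / s + 2 := by positivity
  calc 2 * (3 : ℝ) * (2 * ((2 * n : ℕ) : ℝ) / s + 2) ^ (3 - 1)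
      = 6 * (2 * ((2 * n : ℕ) : ℝ) / s + 2) ^ 2 := by norm_num
    _ ≤ 6 * (10 / ε) ^ 2 := by gcongr
    _ = 600 / ε ^ 2 := by ring

end BoundaryPinning

/-- **Boundary pinning: cell decay `o(ε²)` of the boundary two-distinct-cluster event implies
`NonProliferation`.** With `δ = 1/1200`, mesh `ε`, cell side `s = ⌊εn⌋` (`≥ εn/2` once `εn ≥ 2`), the
grid on `∂ⁱⁿB(2n)` has `≤ 600/ε²` cells of coordinate-diameter `< s ≤ εn` (`stub_boundaryGrid`), so by
pigeonhole and the union bound (`stub_cellUnionBound`) `P(N_n ≥ #cells + 1) ≤ (600/ε²)(ε²/1200) = 1/2`;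
with `M := ⌊600/ε²⌋ ≥ #cells` and antitonicity of `repEvent` in `M`, `P(N_n ≤ M) ≥ 1/2` for infinitely
many `n`. The hypothesis is the line's single open stub (`stub_boundaryCellTwoArm`), the `d = 3` input. -/
theorem nonProliferation_of_boundaryCellTwoArm :
    (∀ δ : ℝ, 0 < δ → ∃ ε : ℝ, 0 < ε ∧ ε ≤ 1 ∧ ∃ᶠ n : ℕ in atTop,
      ∀ Q : Finset (Site 3), Q ⊆ innerBoundary (zdGraph 3) (box 3 (2 * n)) →
        (∀ u ∈ Q, ∀ v ∈ Q, ∀ i : Fin 3, ((|u i - v i| : ℤ) : ℝ) ≤ ε * n) →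
        (bondPercolation (zdGraph 3) (criticalProbI 3)).real
          {ω | ∃ u ∈ Q, ∃ v ∈ Q, (∃ a ∈ box 3 n, ω ∈ openConnIn (↑(box 3 (2 * n)) : Set (Site 3)) u a) ∧
            (∃ b ∈ box 3 n, ω ∈ openConnIn (↑(box 3 (2 * n)) : Set (Site 3)) v b) ∧
            ω ∉ openConnIn (↑(box 3 (2 * n)) : Set (Site 3)) u v} ≤ δ * ε ^ 2) →
    Summit.CriticalPhenomena.PercolationContinuityZ3.Theses.PercNonProliferation.NonProliferation := by
  intro h
  rw [nonProliferation_iff]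
  obtain ⟨ε, hε0, hε1, hfreq⟩ := h (1 / 1200) (by norm_num)
  refine ⟨⌊600 / ε ^ 2⌋₊, 1 / 2, by norm_num, ?_⟩
  have hev : ∀ᶠ n : ℕ in atTop, 2 ≤ ε * n := by
    refine (eventually_ge_atTop ⌈2 / ε⌉₊).mono fun n hn => ?_
    have h' : 2 / ε ≤ n := (Nat.le_ceil _).trans (by exact_mod_cast hn)
    rwa [div_le_iff₀ hε0, mul_comm] at h'
  refine (hfreq.and_eventually hev).mono fun n hn => ?_
  obtain ⟨hQ, hn2⟩ := hn
  set μ : Measure (BondConfig (Site 3)) := bondPercolation (zdGraph 3) (criticalProbI 3) with hμ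
  -- the grid at radius `2n`, cell side `s = ⌊ε n⌋ ≥ 1`
  set s : ℕ := ⌊ε * n⌋₊ with hs
  have hs1 : 1 ≤ s := by
    rw [hs, Nat.one_le_floor_iff]; linarith
  obtain ⟨𝒬, hsub, hdiam, -, hcov, hcount⟩ := stub_boundaryGrid 3 (2 * n) s hs1
  have hs_le : (s : ℝ) ≤ ε * n := Nat.floor_le (by positivity)
  -- per-cell bound from the hypothesis
  have hcell : ∀ Q ∈ 𝒬, μ.real
      {ω | ∃ u ∈ Q, ∃ v ∈ Q, (∃ a ∈ box 3 n, ω ∈ openConnIn (↑(box 3 (2 * n)) : Set (Site 3)) u a) ∧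
        (∃ b ∈ box 3 n, ω ∈ openConnIn (↑(box 3 (2 * n)) : Set (Site 3)) v b) ∧
        ω ∉ openConnIn (↑(box 3 (2 * n)) : Set (Site 3)) u v} ≤ 1 / 1200 * ε ^ 2 := by
    intro Q hQ𝒬
    refine hQ Q (hsub Q hQ𝒬) fun u hu v hv i => ?_
    have h := hdiam Q hQ𝒬 u hu v hv i
    have h' : ((|u i - v i| : ℤ) : ℝ) + 1 ≤ s := by exact_mod_cast h
    linarith
  -- union bound + count
  have hunion : μ.real (repEvent 3 𝒬.card n) ≤ 1 / 2 := by
    calc μ.real (repEvent 3 𝒬.card n)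
        ≤ ∑ Q ∈ 𝒬, μ.real
            {ω | ∃ u ∈ Q, ∃ v ∈ Q, (∃ a ∈ box 3 n, ω ∈ openConnIn (↑(box 3 (2 * n)) : Set (Site 3)) u a) ∧
              (∃ b ∈ box 3 n, ω ∈ openConnIn (↑(box 3 (2 * n)) : Set (Site 3)) v b) ∧
              ω ∉ openConnIn (↑(box 3 (2 * n)) : Set (Site 3)) u v} :=
          stub_cellUnionBound 3 n (criticalProbI 3) 𝒬 hcov
      _ ≤ ∑ Q ∈ 𝒬, 1 / 1200 * ε ^ 2 := Finset.sum_le_sum hcell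
      _ = 𝒬.card * (1 / 1200 * ε ^ 2) := by rw [Finset.sum_const, nsmul_eq_mul]
      _ ≤ 600 / ε ^ 2 * (1 / 1200 * ε ^ 2) := by
          gcongr
          exact hcount.trans (BoundaryPinning.grid_count_le hε0 hε1 hn2 hs)
      _ = 1 / 2 := by field_simp; ring
  -- pass to the fixed `M = ⌊600/ε²⌋ ≥ #cells`
  have hM : 𝒬.card ≤ ⌊600 / ε ^ 2⌋₊ :=
    Nat.le_floor (hcount.trans (BoundaryPinning.grid_count_le hε0 hε1 hn2 hs))
  have hmono : μ.real (repEvent 3 ⌊600 / ε ^ 2⌋₊ n) ≤ μ.real (repEvent 3 𝒬.card n) :=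
    measureReal_mono (repEvent_antitone 3 n hM) (measure_ne_top _ _)
  rw [probReal_compl_eq_one_sub (measurableSet_repEvent 3 _ n)]
  linarith

/-- **The exponent form implies the `o(ε²)` cell form** (even EVENTUALLY in `n`): if
`P(faceTwoArm n Q) ≤ C (r/n)^a` for all cells `Q ⊆ ∂ⁱⁿB(2n)` of coordinate-diameter `≤ r`, `1 ≤ r ≤ n`,
with `a > 2`, then for every `δ > 0`, with `ε := min 1 ((δ/K)^{1/(a-2)})`, `K := C⁺ 2^a + 1`,
`C⁺ := max C 0`, and `r := ⌈εn⌉ ≤ 2εn` (once `εn ≥ 1`): `P ≤ C⁺ (2ε)^a = C⁺ 2^a ε^{a-2} ε² ≤ δ ε²`. -/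
theorem boundaryCellTwoArm_of_exp :
    (∃ a C : ℝ, 2 < a ∧ ∀ n : ℕ, 1 ≤ n → ∀ r : ℕ, 1 ≤ r → r ≤ n → ∀ Q : Finset (Site 3),
      Q ⊆ innerBoundary (zdGraph 3) (box 3 (2 * n)) →
      (∀ u ∈ Q, ∀ v ∈ Q, ∀ i : Fin 3, |u i - v i| ≤ (r : ℤ)) →
        (bondPercolation (zdGraph 3) (criticalProbI 3)).real
          {ω | ∃ u ∈ Q, ∃ v ∈ Q, (∃ a ∈ box 3 n, ω ∈ openConnIn (↑(box 3 (2 * n)) : Set (Site 3)) u a) ∧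
            (∃ b ∈ box 3 n, ω ∈ openConnIn (↑(box 3 (2 * n)) : Set (Site 3)) v b) ∧
            ω ∉ openConnIn (↑(box 3 (2 * n)) : Set (Site 3)) u v} ≤ C * ((r : ℝ) / n) ^ a) →
    ∀ δ : ℝ, 0 < δ → ∃ ε : ℝ, 0 < ε ∧ ε ≤ 1 ∧ ∃ᶠ n : ℕ in atTop,
      ∀ Q : Finset (Site 3), Q ⊆ innerBoundary (zdGraph 3) (box 3 (2 * n)) →
        (∀ u ∈ Q, ∀ v ∈ Q, ∀ i : Fin 3, ((|u i - v i| : ℤ) : ℝ) ≤ ε * n) →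
        (bondPercolation (zdGraph 3) (criticalProbI 3)).real
          {ω | ∃ u ∈ Q, ∃ v ∈ Q, (∃ a ∈ box 3 n, ω ∈ openConnIn (↑(box 3 (2 * n)) : Set (Site 3)) u a) ∧
            (∃ b ∈ box 3 n, ω ∈ openConnIn (↑(box 3 (2 * n)) : Set (Site 3)) v b) ∧
            ω ∉ openConnIn (↑(box 3 (2 * n)) : Set (Site 3)) u v} ≤ δ * ε ^ 2 := by
  rintro ⟨a, C, ha, hexp⟩
  intro δ hδ
  set C' : ℝ := max C 0 with hC'
  have hC'0 : 0 ≤ C' := le_max_right _ _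
  have hCC' : C ≤ C' := le_max_left _ _
  set K : ℝ := C' * (2 : ℝ) ^ a + 1 with hK
  have h2a : (0 : ℝ) < (2 : ℝ) ^ a := Real.rpow_pos_of_pos two_pos a
  have hK0 : 0 < K := by have := mul_nonneg hC'0 h2a.le; linarith
  have ha2 : 0 < a - 2 := by linarith
  set ε : ℝ := min 1 ((δ / K) ^ (a - 2)⁻¹) with hε
  have hq0 : 0 < (δ / K) ^ (a - 2)⁻¹ := Real.rpow_pos_of_pos (div_pos hδ hK0) _
  have hε0 : 0 < ε := lt_min one_pos hq0
  have hε1 : ε ≤ 1 := min_le_left _ _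
  have hεa : ε ^ (a - 2) ≤ δ / K := by
    calc ε ^ (a - 2) ≤ ((δ / K) ^ (a - 2)⁻¹) ^ (a - 2) :=
          Real.rpow_le_rpow hε0.le (min_le_right _ _) ha2.le
      _ = δ / K := Real.rpow_inv_rpow (div_pos hδ hK0).le ha2.ne'
  refine ⟨ε, hε0, hε1, Eventually.frequently ?_⟩
  have hev : ∀ᶠ n : ℕ in atTop, 1 ≤ ε * n := by
    refine (eventually_ge_atTop ⌈1 / ε⌉₊).mono fun n hn => ?_
    have h' : 1 / ε ≤ n := (Nat.le_ceil _).trans (by exact_mod_cast hn)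
    rwa [div_le_iff₀ hε0, mul_comm] at h'
  filter_upwards [hev, eventually_ge_atTop 1] with n hn hn1
  intro Q hQ hdiam
  have hn0 : (0 : ℝ) < n := by exact_mod_cast hn1
  -- integer radius `r = ⌈ε n⌉`, `1 ≤ r ≤ n`, `r ≤ 2 ε n`
  set r : ℕ := ⌈ε * n⌉₊ with hr
  have hr1 : 1 ≤ r := by
    rw [hr, Nat.one_le_ceil_iff]; linarith
  have hrn : r ≤ n := by
    rw [hr, Nat.ceil_le]
    calc ε * n ≤ 1 * n := by gcongr
      _ = n := one_mul _
  have hr2 : (r : ℝ) ≤ 2 * (ε * n) := by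
    have : (r : ℝ) < ε * n + 1 := by rw [hr]; exact Nat.ceil_lt_add_one (by positivity)
    linarith
  have hdiam' : ∀ u ∈ Q, ∀ v ∈ Q, ∀ i : Fin 3, |u i - v i| ≤ (r : ℤ) := by
    intro u hu v hv i
    have h1 := hdiam u hu v hv i
    have h2 : ε * n ≤ r := by rw [hr]; exact Nat.le_ceil _
    exact_mod_cast h1.trans h2
  refine (hexp n hn1 r hr1 hrn Q hQ hdiam').trans ?_
  have hrn0 : (0 : ℝ) ≤ (r : ℝ) / n := by positivity
  have hrn2 : (r : ℝ) / n ≤ 2 * ε := by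
    rw [div_le_iff₀ hn0]; linarith
  calc C * ((r : ℝ) / n) ^ a ≤ C' * ((r : ℝ) / n) ^ a := by
        gcongr
    _ ≤ C' * (2 * ε) ^ a := by
        gcongr
    _ = C' * (2 : ℝ) ^ a * (ε ^ (a - 2) * ε ^ 2) := by
        rw [Real.mul_rpow two_pos.le hε0.le, ← Real.rpow_two, ← Real.rpow_add hε0]
        ring_nf
    _ ≤ C' * (2 : ℝ) ^ a * (δ / K * ε ^ 2) := by
        gcongr
    _ = (C' * (2 : ℝ) ^ a / K) * δ * ε ^ 2 := by
        field_simp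
    _ ≤ 1 * δ * ε ^ 2 := by
        gcongr
        rw [div_le_one hK0, hK]; linarith
    _ = δ * ε ^ 2 := by ring

end Summit.CriticalPhenomena.PercolationContinuityZ3.Theorems.NonProliferation

end
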